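import Literature.NumberTheory.GaloisRepresentations.PowLocallyAlgebraicQuadraticProofs
import Mathlib.GroupTheory.FiniteAbelian.Duality
import Mathlib.RingTheory.RootsOfUnity.AlgebraicallyClosed
import HarnessLib

/-!
# Böckle–Hui Thm. 2.2 over composites of quadratic fields; Thm. 1.1 (characters) there (proved)

Topic `NumberTheory/GaloisRepresentations`; namespace
`Literature.NumberTheory.GaloisRepresentations`.  A *proofs* file (theorems only; no definition,
no named fact, no instance).

**Theorem** (`MultiQuadratic.pow_isLocallyAlgebraic_of_frobenius_isAlgebraic_multiquadratic`).
The hypothesis `h22` of `exists_heckeCharacter_of_weaklyDivides_of_thm22` — Böckle–Hui's Thm. 2.2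
in the tree's idelic rendering — HOLDS for every Galois number field `K/ℚ` whose Galois group has
exponent `2` (a composite of quadratic fields).  Hence
(`exists_heckeCharacter_of_weaklyDivides_multiquadratic`) Böckle–Hui's Thm. 1.1 for characters
(Hecke form of the named fact `exists_heckeCharacter_of_weaklyDivides`) holds unconditionally over
such fields.  This is Serre's theorem, *Abelian ℓ-adic representations* (1968), Ch. III §3.4
("`K` a composite of quadratic extensions of `ℚ`"), with the `ℓ`-adic six exponentials theorem as
its only transcendence input: for each `±1`-character `χ` of `G = Gal(K/ℚ)` the eigen-elements
`k_χ = ∏_g g(k)^{χ(g)}` satisfy `h(k_χ) = k_χ^{χ(h)}`, so along them the analytic expansion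
(`Expansion.exists_expansion`) is a one-variable function and the generic eigen-line lemma `line`
(six exponentials at test elements supported on degree-one primes stable under no `g ≠ 1`) gives
`F(k_χ)^{B_χ} = τ₁(k_χ)^{A_χ}`; and `∏_χ k_χ = k^{#X}` by the orthogonality of the `±1`-characters
(Mathlib duality `CommGroup.exists_apply_ne_one_of_hasEnoughRootsOfUnity`, `sum_hom_units_eq_zero`).

## Contents

* C3 `line` — the abstract eigen-line lemma (six exponentials, rescaled).
* C1 Galois bookkeeping: embeddings `= τ₁ ∘ g`, `±1`-characters, orthogonality, eigen-elements.
* C2 `exists_test_elements'` — test primes/elements for all automorphisms at once (density one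
  of degree-one primes stable under no non-trivial automorphism; Chinese remainder theorem).
* C4 the theorem and the corollary.

## References

* J.-P. Serre, *Abelian ℓ-adic representations and elliptic curves* (1968), Ch. III §3.4.
  [SerreAbelianLadic1968]
* S. Lang, *Introduction to transcendental numbers* (1966), Ch. II §1. [Lang1966]
* G. Böckle, C.-Y. Hui, Math. Ann. 393 (2025), Thm. 1.1, Thm. 2.2. [BockleHui2025]
-/

noncomputable section

open scoped NumberField Polynomial
open NumberField IsDedekindDomain IsDedekindDomain.HeightOneSpectrum Filter Topology Finset NormedSpace
  Field Polynomial
open Literature.NumberTheory.Transcendental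
open Literature.NumberTheory.LFunctions.NumberField (HasDirichletDensity)


namespace Literature.NumberTheory.GaloisRepresentations

namespace MultiQuadratic


variable {K : Type} [Field K] [NumberField K] {ℓ : ℕ} [Fact ℓ.Prime]
variable {E : Type} [NontriviallyNormedField E] [NormedAlgebra ℚ_[ℓ] E] [IsUltrametricDist E]
  [CompleteSpace E]

/-- **The eigen-line lemma** (abstract form of `Quadratic.rational_line` / `Quadratic.anti_line`).
Let `Θ : Kˣ → Kˣ` (an eigen-projection), `F : Kˣ → E` multiplicative, `τ₁ : K → ℚ̄_ℓ`, and suppose: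
for every depth `s' ≥ s` there are test elements `k₁, k₂, k₃ ≡ 1 [ℓ^{s'}]` and places `𝔭ⱼ` with
`F(Θ kⱼ)` algebraic, `Θ kⱼ ≡ 1 [ℓ^{s'}]`, `|Θ kⱼ|_{𝔭ᵢ} = 1` for `i ≠ j` and `|Θ kⱼ|_{𝔭ⱼ} < 1`; and on
the line, for `k ≡ 1 [ℓ^s]`, `ι τ₁(Θ k) = exp(M · L(ι τ₁ Θ k))`, `F(Θ k) = exp(Λ · L(ι τ₁ Θ k))` with
exponents of norm `< ℓ⁻¹`.  Then `F(Θ k)^B = (ι τ₁ Θ k)^A` for some `B ≥ 1`, `A ∈ ℤ`, all such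
`k` (the `ℓ`-adic six exponentials theorem). [cite: SerreAbelianLadic1968, Ch. III §3]
[cite: Lang1966, Ch. II §1 Thm. 1] -/
theorem line (ιE : PadicAlgCl ℓ →+* E) (hι : ∀ x, ‖ιE x‖ = ‖x‖) (τ₁ : K →+* PadicAlgCl ℓ)
    (Θ : Kˣ → Kˣ) (F : Kˣ →* E) {s : ℕ} (hs : 2 ≤ s) (Λ M : E)
    (htest : ∀ s' : ℕ, s ≤ s' → ∃ (kk : Fin 3 → Kˣ) (𝔭 : Fin 3 → HeightOneSpectrum (𝓞 K)),
      (∀ j, ∀ v : HeightOneSpectrum (𝓞 K), (ℓ : 𝓞 K) ∈ v.asIdeal →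
        v.valuation K ((kk j : K) - 1) ≤ v.valuation K ((ℓ : K) ^ s')) ∧
      (∀ j, ∀ v : HeightOneSpectrum (𝓞 K), (ℓ : 𝓞 K) ∈ v.asIdeal →
        v.valuation K (((Θ (kk j) : Kˣ) : K) - 1) ≤ v.valuation K ((ℓ : K) ^ s')) ∧
      (∀ j, IsAlgebraic ℤ (F (Θ (kk j)))) ∧
      (∀ i j, i ≠ j → (𝔭 i).valuation K ((Θ (kk j) : Kˣ) : K) = 1) ∧
      (∀ j, (𝔭 j).valuation K ((Θ (kk j) : Kˣ) : K) < 1))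
    (hline : ∀ k : Kˣ, (∀ v : HeightOneSpectrum (𝓞 K), (ℓ : 𝓞 K) ∈ v.asIdeal →
        v.valuation K ((k : K) - 1) ≤ v.valuation K ((ℓ : K) ^ s)) →
      ‖M * ∑' m : ℕ, -((1 - ιE (τ₁ (Θ k : K))) ^ (m + 1)) / (m + 1 : E)‖ < (ℓ : ℝ)⁻¹ ∧
      ‖Λ * ∑' m : ℕ, -((1 - ιE (τ₁ (Θ k : K))) ^ (m + 1)) / (m + 1 : E)‖ < (ℓ : ℝ)⁻¹ ∧
      ιE (τ₁ (Θ k : K)) =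
        exp (M * ∑' m : ℕ, -((1 - ιE (τ₁ (Θ k : K))) ^ (m + 1)) / (m + 1 : E)) ∧
      F (Θ k) = exp (Λ * ∑' m : ℕ, -((1 - ιE (τ₁ (Θ k : K))) ^ (m + 1)) / (m + 1 : E))) :
    ∃ B : ℕ, 0 < B ∧ ∃ A : ℤ, ∀ k : Kˣ, (∀ v : HeightOneSpectrum (𝓞 K), (ℓ : 𝓞 K) ∈ v.asIdeal →
        v.valuation K ((k : K) - 1) ≤ v.valuation K ((ℓ : K) ^ s)) →
      F (Θ k) ^ B = (ιE (τ₁ (Θ k : K))) ^ A := by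
  classical
  haveI : CharZero E := charZero_of_injective_algebraMap (algebraMap ℚ_[ℓ] E).injective
  have hp : ℓ.Prime := Fact.out
  set q₀ : ℝ := (ℓ : ℝ)⁻¹ with hq₀def
  have hq0 : 0 < q₀ := inv_pos.mpr (by exact_mod_cast hp.pos)
  have hq1 : q₀ < 1 := inv_lt_one_of_one_lt₀ (by exact_mod_cast hp.one_lt)
  have hq2 : q₀ ≤ 1 / 2 := by
    rw [hq₀def, one_div]; exact inv_anti₀ two_pos (by exact_mod_cast hp.two_le)
  by_cases hli : ¬ LinearIndependent ℤ ![M, Λ]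
  · rw [LinearIndependent.pair_iff] at hli
    push Not at hli
    obtain ⟨a, b, hrel, hab⟩ := hli
    have hline' : ∀ k : Kˣ, (∀ v : HeightOneSpectrum (𝓞 K), (ℓ : 𝓞 K) ∈ v.asIdeal →
        v.valuation K ((k : K) - 1) ≤ v.valuation K ((ℓ : K) ^ s)) →
        (ιE (τ₁ (Θ k : K))) ^ a * F (Θ k) ^ b = 1 := by
      intro k hk
      obtain ⟨h1, h2, h3, h4⟩ := hline k hk
      conv_lhs => rw [h3, h4]
      exact Quadratic.exp_zpow_mul_exp_zpow_eq_one (ℓ := ℓ) hrel h1 h2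
    have hb : b ≠ 0 := by
      intro hb0
      have ha0 : a ≠ 0 := fun h => hab h hb0
      obtain ⟨kk, 𝔭, hkc, -, -, -, hlt⟩ := htest s le_rfl
      have h1 := hline' (kk 0) (hkc 0)
      rw [hb0, zpow_zero, mul_one, ← map_zpow₀, ← map_zpow₀, ← map_one ιE, ← map_one τ₁] at h1
      have h2 : ((Θ (kk 0) : Kˣ) : K) ^ a = 1 := τ₁.injective (ιE.injective h1)
      have h3 := congrArg ((𝔭 0).valuation K) h2
      rw [map_zpow₀, Valuation.map_one] at h3
      have hx0 : (𝔭 0).valuation K ((Θ (kk 0) : Kˣ) : K) ≠ 0 :=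
        (Valuation.ne_zero_iff _).mpr (Θ (kk 0)).ne_zero
      rcases lt_or_gt_of_ne ha0 with hneg | hpos
      · have h4 : (𝔭 0).valuation K ((Θ (kk 0) : Kˣ) : K) ^ (-a).toNat =
            (𝔭 0).valuation K ((Θ (kk 0) : Kˣ) : K) ^ 0 := by
          rw [pow_zero, ← zpow_natCast, Int.toNat_of_nonneg (by omega), zpow_neg, h3, inv_one]
        have := Quadratic.pow_injective_of_lt_one hx0 (hlt 0) h4
        omega
      · have h4 : (𝔭 0).valuation K ((Θ (kk 0) : Kˣ) : K) ^ a.toNat =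
            (𝔭 0).valuation K ((Θ (kk 0) : Kˣ) : K) ^ 0 := by
          rw [pow_zero, ← zpow_natCast, Int.toNat_of_nonneg hpos.le, h3]
        have := Quadratic.pow_injective_of_lt_one hx0 (hlt 0) h4
        omega
    rcases lt_or_gt_of_ne hb with hneg | hpos
    · refine ⟨(-b).toNat, by omega, a, fun k hk => ?_⟩
      have h2 : F (Θ k) ^ b = ((ιE (τ₁ (Θ k : K))) ^ a)⁻¹ :=
        eq_inv_of_mul_eq_one_right (hline' k hk)
      have e : (((-b).toNat : ℕ) : ℤ) = -b := Int.toNat_of_nonneg (by omega)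
      rw [← zpow_natCast, e, zpow_neg, h2, inv_inv]
    · refine ⟨b.toNat, by omega, -a, fun k hk => ?_⟩
      have h2 : F (Θ k) ^ b = ((ιE (τ₁ (Θ k : K))) ^ a)⁻¹ :=
        eq_inv_of_mul_eq_one_right (hline' k hk)
      have e : ((b.toNat : ℕ) : ℤ) = b := Int.toNat_of_nonneg hpos.le
      rw [← zpow_natCast, e, h2, zpow_neg]
  · exfalso
    push Not at hli
    refine Quadratic.not_linearIndependent_of_exp_isAlgebraic (ℓ := ℓ) ![M, Λ] (fun t => ?_) hli
    set s' : ℕ := s + t + 1 with hs'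
    obtain ⟨kk, 𝔭, hkc, hΘc, halgF, hval1, hlt⟩ := htest s' (by omega)
    have hkcs : ∀ j, ∀ v : HeightOneSpectrum (𝓞 K), (ℓ : 𝓞 K) ∈ v.asIdeal →
        v.valuation K ((kk j : K) - 1) ≤ v.valuation K ((ℓ : K) ^ s) :=
      fun j => Cong.mono (hkc j) (by omega)
    have hnorm1 : ∀ j, ‖1 - ιE (τ₁ ((Θ (kk j) : Kˣ) : K))‖ ≤ q₀ ^ s' := by
      intro j
      rw [← map_one ιE, ← map_sub, hι, ← map_one τ₁, ← map_sub, ← neg_sub, map_neg, norm_neg]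
      exact Expansion.norm_embedding_le_of_cong (hΘc j) τ₁
    have hs'2 : 2 ≤ s' := by omega
    have hqs'4 : q₀ ^ s' ≤ 1 / 4 := by
      calc q₀ ^ s' ≤ q₀ ^ 2 := pow_le_pow_of_le_one hq0.le hq1.le hs'2
        _ ≤ (1 / 2) ^ 2 := pow_le_pow_left₀ hq0.le hq2 2
        _ = 1 / 4 := by norm_num
    have hqs'1 : q₀ ^ s' < 1 := pow_lt_one₀ hq0.le hq1 (by omega)
    set y : Fin 3 → E := fun j =>
      ∑' m : ℕ, -((1 - ιE (τ₁ ((Θ (kk j) : Kˣ) : K))) ^ (m + 1)) / (m + 1 : E) with hydef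
    refine ⟨y, ?_, fun j => ?_, fun i j => ?_⟩
    · rw [Fintype.linearIndependent_iff]
      intro g hg j0
      set kp : Fin 3 → ℕ := fun j => (g j).toNat with hkp
      set kn : Fin 3 → ℕ := fun j => (-g j).toNat with hkn
      have hk_eq : ∀ j, (g j : ℤ) = kp j - kn j := fun j => by simp only [hkp, hkn]; omega
      have hprin : ∀ j, ‖1 - ιE (τ₁ ((Θ (kk j) : Kˣ) : K))‖ < 1 := fun j =>
        (hnorm1 j).trans_lt hqs'1
      have hLA := LogE.logSeries_prod_pow (ℓ := ℓ) Finset.univ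
        (fun j => ιE (τ₁ ((Θ (kk j) : Kˣ) : K))) kp (fun j _ => hprin j)
      have hLB := LogE.logSeries_prod_pow (ℓ := ℓ) Finset.univ
        (fun j => ιE (τ₁ ((Θ (kk j) : Kˣ) : K))) kn (fun j _ => hprin j)
      have hsum : ∑ j, ((kp j : E)) * y j = ∑ j, ((kn j : E)) * y j := by
        rw [← sub_eq_zero, ← Finset.sum_sub_distrib, ← hg]
        refine Finset.sum_congr rfl fun j _ => ?_
        rw [zsmul_eq_mul, hk_eq]; push_cast; ring
      have hLAB : (∑' m : ℕ, -((1 - ∏ j, ιE (τ₁ ((Θ (kk j) : Kˣ) : K)) ^ kp j) ^ (m + 1)) /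
          (m + 1 : E)) = ∑' m : ℕ, -((1 - ∏ j, ιE (τ₁ ((Θ (kk j) : Kˣ) : K)) ^ kn j) ^ (m + 1)) /
          (m + 1 : E) := by
        rw [hLA, hLB]; exact hsum
      have hAB : ∏ j, ιE (τ₁ ((Θ (kk j) : Kˣ) : K)) ^ kp j =
          ∏ j, ιE (τ₁ ((Θ (kk j) : Kˣ) : K)) ^ kn j :=
        LogE.eq_of_logSeries_eq (ℓ := ℓ)
          ((Quadratic.norm_one_sub_prod_pow_le _ _ _ (pow_nonneg hq0.le _) hqs'1
            fun j _ => hnorm1 j).trans hqs'4)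
          ((Quadratic.norm_one_sub_prod_pow_le _ _ _ (pow_nonneg hq0.le _) hqs'1
            fun j _ => hnorm1 j).trans hqs'4)
          hLAB
      have hK : ∏ j, ((Θ (kk j) : Kˣ) : K) ^ kp j = ∏ j, ((Θ (kk j) : Kˣ) : K) ^ kn j := by
        apply τ₁.injective
        apply ιE.injective
        simpa only [map_prod, map_pow] using hAB
      have hv := congrArg ((𝔭 j0).valuation K) hK
      rw [map_prod, map_prod] at hv
      simp only [map_pow] at hv
      rw [Finset.prod_eq_single j0 (fun j _ hj => by rw [hval1 j0 j (Ne.symm hj), one_pow])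
          (fun h => absurd (Finset.mem_univ j0) h),
        Finset.prod_eq_single j0 (fun j _ hj => by rw [hval1 j0 j (Ne.symm hj), one_pow])
          (fun h => absurd (Finset.mem_univ j0) h)] at hv
      have hx0 : (𝔭 j0).valuation K ((Θ (kk j0) : Kˣ) : K) ≠ 0 :=
        (Valuation.ne_zero_iff _).mpr (Θ (kk j0)).ne_zero
      have := Quadratic.pow_injective_of_lt_one hx0 (hlt j0) hv
      rw [hk_eq j0]
      omega
    · change ‖∑' m : ℕ, -((1 - ιE (τ₁ ((Θ (kk j) : Kˣ) : K))) ^ (m + 1)) / (m + 1 : E)‖ ≤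
        q₀ ^ (t + 1)
      rw [LogE.norm_logSeries_eq (ℓ := ℓ) ((hnorm1 j).trans hqs'4)]
      exact (hnorm1 j).trans (pow_le_pow_of_le_one hq0.le hq1.le (by omega))
    · obtain ⟨h1, h2, h3, h4⟩ := hline (kk j) (hkcs j)
      fin_cases i
      · change IsAlgebraic ℤ (exp (M * y j))
        rw [← h3]
        have halgK : IsAlgebraic ℤ ((Θ (kk j) : Kˣ) : K) :=
          (IsFractionRing.isAlgebraic_iff ℤ ℚ K).mpr (Algebra.IsAlgebraic.isAlgebraic _)
        exact FramedGaloisRep.isAlgebraic_int_map (instA := Ring.toIntAlgebra K)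
          (instB := Ring.toIntAlgebra E) (ιE.comp τ₁) halgK
      · change IsAlgebraic ℤ (exp (Λ * y j))
        rw [← h4]
        exact halgF j

end MultiQuadratic

end Literature.NumberTheory.GaloisRepresentations

/-! ### C1. Elementary abelian `2`-extensions: embeddings, `±1`-characters, eigen-elements -/

namespace Literature.NumberTheory.GaloisRepresentations

namespace MultiQuadratic


section Galois

variable {K : Type} [Field K] [NumberField K]

/-- In a group of exponent two, `g⁻¹ = g`. [folklore] -/
theorem inv_eq_self' (h2 : ∀ g : K ≃ₐ[ℚ] K, g * g = 1) (g : K ≃ₐ[ℚ] K) : g⁻¹ = g :=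
  inv_eq_of_mul_eq_one_left (h2 g)

/-- A group of exponent two is commutative. [folklore] -/
theorem mul_comm' (h2 : ∀ g : K ≃ₐ[ℚ] K, g * g = 1) (g h : K ≃ₐ[ℚ] K) : g * h = h * g := by
  calc g * h = (g * h)⁻¹ := (inv_eq_self' h2 (g * h)).symm
    _ = h * g := by rw [mul_inv_rev, inv_eq_self' h2 h, inv_eq_self' h2 g]

/-- `g (g x) = x` in an elementary abelian `2`-extension. [folklore] -/
theorem aut_aut' (h2 : ∀ g : K ≃ₐ[ℚ] K, g * g = 1) (g : K ≃ₐ[ℚ] K) (x : K) : g (g x) = x := by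
  rw [← AlgEquiv.mul_apply, h2, AlgEquiv.one_apply]

variable {ℓ : ℕ} [Fact ℓ.Prime]

/-- **The embeddings of a Galois number field are `τ₁ ∘ g`**, `g ∈ Gal(K/ℚ)`, bijectively.
[folklore] -/
theorem bijective_comp [IsGalois ℚ K] (τ₁ : K →+* PadicAlgCl ℓ) :
    Function.Bijective fun g : K ≃ₐ[ℚ] K => τ₁.comp (g : K →+* K) := by
  classical
  rw [Fintype.bijective_iff_injective_and_card]
  refine ⟨fun g g' h => ?_, ?_⟩
  · ext x
    have := RingHom.congr_fun h x
    simp only [RingHom.coe_comp, Function.comp_apply, RingHom.coe_coe] at this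
    exact τ₁.injective this
  · rw [← Nat.card_eq_fintype_card, IsGalois.card_aut_eq_finrank, Embeddings.card]

/-- Sums over the embeddings as sums over the Galois group. [folklore] -/
theorem sum_embeddings [IsGalois ℚ K] (τ₁ : K →+* PadicAlgCl ℓ) {β : Type*} [AddCommMonoid β]
    (f : (K →+* PadicAlgCl ℓ) → β) :
    ∑ τ, f τ = ∑ g : K ≃ₐ[ℚ] K, f (τ₁.comp (g : K →+* K)) :=
  (Function.Bijective.sum_comp (bijective_comp τ₁) f).symm

/-- Products over the embeddings as products over the Galois group. [folklore] -/
theorem prod_embeddings [IsGalois ℚ K] (τ₁ : K →+* PadicAlgCl ℓ) {β : Type*} [CommMonoid β]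
    (f : (K →+* PadicAlgCl ℓ) → β) :
    ∏ τ, f τ = ∏ g : K ≃ₐ[ℚ] K, f (τ₁.comp (g : K →+* K)) :=
  (Function.Bijective.prod_comp (bijective_comp τ₁) f).symm

/-! #### `±1`-valued characters -/

/-- The value of a `ℤˣ`-character as an integer is `±1`. [folklore] -/
theorem coe_chi_eq (χ : (K ≃ₐ[ℚ] K) →* ℤˣ) (g : K ≃ₐ[ℚ] K) :
    ((χ g : ℤˣ) : ℤ) = 1 ∨ ((χ g : ℤˣ) : ℤ) = -1 := by
  rcases Int.units_eq_one_or (χ g) with h | h <;> simp [h]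

/-- `χ(g⁻¹) = χ(g)` as integers (values `±1`). [folklore] -/
theorem coe_chi_inv (χ : (K ≃ₐ[ℚ] K) →* ℤˣ) (g : K ≃ₐ[ℚ] K) :
    ((χ g⁻¹ : ℤˣ) : ℤ) = ((χ g : ℤˣ) : ℤ) := by
  rw [map_inv]
  rcases Int.units_eq_one_or (χ g) with h | h <;> simp [h]

/-- `χ(g)² = 1` as integers. [folklore] -/
theorem coe_chi_mul_self (χ : (K ≃ₐ[ℚ] K) →* ℤˣ) (g : K ≃ₐ[ℚ] K) :
    ((χ g : ℤˣ) : ℤ) * ((χ g : ℤˣ) : ℤ) = 1 := by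
  rcases coe_chi_eq χ g with h | h <;> rw [h] <;> norm_num

/-- **Enough `±1`-characters**: in an elementary abelian `2`-group every `g ≠ 1` is detected by a
`ℤˣ`-valued character (duality of finite abelian groups, Mathlib
`CommGroup.exists_apply_ne_one_of_hasEnoughRootsOfUnity` over `ℂ`, read back in `ℤˣ` since the
values are `±1`). [folklore] -/
theorem exists_chi_ne_one (h2 : ∀ g : K ≃ₐ[ℚ] K, g * g = 1) {g : K ≃ₐ[ℚ] K} (hg : g ≠ 1) :
    ∃ χ : (K ≃ₐ[ℚ] K) →* ℤˣ, χ g ≠ 1 := by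
  classical
  letI : CommGroup (K ≃ₐ[ℚ] K) := { (inferInstance : Group (K ≃ₐ[ℚ] K)) with
    mul_comm := mul_comm' h2 }
  haveI : NeZero ((Monoid.exponent (K ≃ₐ[ℚ] K) : ℕ) : ℂ) :=
    ⟨Nat.cast_ne_zero.mpr Monoid.exponent_ne_zero_of_finite⟩
  obtain ⟨φ, hφ⟩ := CommGroup.exists_apply_ne_one_of_hasEnoughRootsOfUnity (K ≃ₐ[ℚ] K) ℂ hg
  -- the values of `φ` are `±1`
  have hval : ∀ h : K ≃ₐ[ℚ] K, φ h = 1 ∨ φ h = -1 := by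
    intro h
    have hsq : ((φ h : ℂˣ) : ℂ) * ((φ h : ℂˣ) : ℂ) = 1 := by
      rw [← Units.val_mul, ← map_mul, h2, map_one, Units.val_one]
    rcases mul_self_eq_one_iff.mp hsq with h1 | h1
    · left; exact Units.ext h1
    · right; exact Units.ext (by rw [h1]; simp)
  -- read `φ` in `ℤˣ`
  let χf : (K ≃ₐ[ℚ] K) → ℤˣ := fun h => if φ h = 1 then 1 else -1
  have hχf : ∀ h, ((χf h : ℤˣ) : ℤ) = if φ h = 1 then 1 else -1 := by
    intro h; simp only [χf]; split_ifs <;> rfl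
  have hneg1 : ((-1 : ℂˣ)) ≠ 1 := by
    intro h
    have := congrArg (fun u : ℂˣ => (u : ℂ)) h
    norm_num at this
  have hmul : ∀ a b, χf (a * b) = χf a * χf b := by
    intro a b
    apply Units.ext
    push_cast
    rw [hχf, hχf, hχf, map_mul]
    rcases hval a with ha | ha <;> rcases hval b with hb | hb <;>
      simp [ha, hb, hneg1]
  refine ⟨{ toFun := χf, map_one' := by
              apply Units.ext; push_cast; rw [hχf, map_one, if_pos rfl]
            map_mul' := hmul }, ?_⟩
  change χf g ≠ 1
  intro h1
  have := congrArg (fun u : ℤˣ => (u : ℤ)) h1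
  simp only [hχf, Units.val_one] at this
  by_cases hφ1 : φ g = 1
  · exact hφ hφ1
  · simp [hφ1] at this

/-- **Orthogonality of the `±1`-characters**: `∑_χ χ(g) = 0` for `g ≠ 1` (and `= #X` for `g = 1`).
[folklore] -/
theorem sum_coe_chi [Fintype ((K ≃ₐ[ℚ] K) →* ℤˣ)] [DecidableEq (K ≃ₐ[ℚ] K)]
    (h2 : ∀ g : K ≃ₐ[ℚ] K, g * g = 1)
    (g : K ≃ₐ[ℚ] K) :
    ∑ χ : (K ≃ₐ[ℚ] K) →* ℤˣ, ((χ g : ℤˣ) : ℤ) =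
      if g = 1 then (Fintype.card ((K ≃ₐ[ℚ] K) →* ℤˣ) : ℤ) else 0 := by
  classical
  split_ifs with hg
  · simp [hg]
  · -- the evaluation character of the (finite abelian) character group is non-trivial
    set ev : ((K ≃ₐ[ℚ] K) →* ℤˣ) →* ℤ :=
      { toFun := fun χ => ((χ g : ℤˣ) : ℤ)
        map_one' := rfl
        map_mul' := fun _ _ => by simp } with hev
    have hne : ev ≠ 1 := by
      obtain ⟨χ, hχ⟩ := exists_chi_ne_one h2 hg
      intro h
      apply hχ
      apply Units.ext
      simpa [hev] using DFunLike.congr_fun h χ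
    have := sum_hom_units_eq_zero ev hne
    simpa [hev] using this

/-! #### The eigen-elements `k_χ = ∏_g g(k)^{χ(g)}` -/

/-- `h(k_χ) = k_χ^{χ(h)}` for `k_χ = ∏_g g(k)^{χ(g)}`. [folklore] -/
theorem aut_prod_zpow (χ : (K ≃ₐ[ℚ] K) →* ℤˣ) (k : K) (h : K ≃ₐ[ℚ] K) :
    h (∏ g : K ≃ₐ[ℚ] K, (g k) ^ ((χ g : ℤˣ) : ℤ)) =
      (∏ g : K ≃ₐ[ℚ] K, (g k) ^ ((χ g : ℤˣ) : ℤ)) ^ ((χ h : ℤˣ) : ℤ) := by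
  classical
  rw [map_prod, ← Finset.prod_zpow]
  simp only [map_zpow₀]
  have e1 : ∀ g : K ≃ₐ[ℚ] K, h (g k) ^ ((χ g : ℤˣ) : ℤ) =
      ((h * g) k) ^ (((χ h : ℤˣ) : ℤ) * ((χ (h * g) : ℤˣ) : ℤ)) := by
    intro g
    rw [AlgEquiv.mul_apply, map_mul, Units.val_mul, ← mul_assoc, coe_chi_mul_self, one_mul]
  simp_rw [e1]
  rw [Function.Bijective.prod_comp (Group.mulLeft_bijective h)
    (fun x : K ≃ₐ[ℚ] K => (x k) ^ (((χ h : ℤˣ) : ℤ) * ((χ x : ℤˣ) : ℤ)))]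
  refine Finset.prod_congr rfl fun g _ => ?_
  rw [← zpow_mul, mul_comm]

omit [NumberField K] in
/-- `∏_{i∈s} a^{f i} = a^{∑ f i}` for `a ≠ 0` in a field. [folklore] -/
theorem prod_zpow_eq_zpow_sum {ι : Type*} (s : Finset ι) (f : ι → ℤ) {a : K} (ha : a ≠ 0) :
    ∏ i ∈ s, a ^ f i = a ^ (∑ i ∈ s, f i) := by
  classical
  induction s using Finset.induction_on with
  | empty => simp
  | insert j s hj ih => rw [Finset.prod_insert hj, Finset.sum_insert hj, ih, zpow_add₀ ha]

/-- **`∏_χ k_χ = k^{#X}`** (orthogonality). [folklore] -/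
theorem prod_prod_zpow [Fintype ((K ≃ₐ[ℚ] K) →* ℤˣ)] [DecidableEq (K ≃ₐ[ℚ] K)]
    (h2 : ∀ g : K ≃ₐ[ℚ] K, g * g = 1) {k : K}
    (hk : k ≠ 0) :
    ∏ χ : (K ≃ₐ[ℚ] K) →* ℤˣ, ∏ g : K ≃ₐ[ℚ] K, (g k) ^ ((χ g : ℤˣ) : ℤ) =
      k ^ (Fintype.card ((K ≃ₐ[ℚ] K) →* ℤˣ)) := by
  classical
  rw [Finset.prod_comm]
  have e : ∀ g : K ≃ₐ[ℚ] K, ∏ χ : (K ≃ₐ[ℚ] K) →* ℤˣ, (g k) ^ ((χ g : ℤˣ) : ℤ) =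
      (g k) ^ (∑ χ : (K ≃ₐ[ℚ] K) →* ℤˣ, ((χ g : ℤˣ) : ℤ)) := fun g =>
    prod_zpow_eq_zpow_sum _ _ ((map_ne_zero g).mpr hk)
  simp_rw [e, sum_coe_chi h2]
  rw [Finset.prod_eq_single (1 : K ≃ₐ[ℚ] K) (fun g _ hg => by rw [if_neg hg, zpow_zero])
    (fun h => absurd (Finset.mem_univ _) h), if_pos rfl, AlgEquiv.one_apply, zpow_natCast]

/-- The norm element `∏_g g(k)` is rational. [folklore] -/
theorem exists_algebraMap_eq_prod [IsGalois ℚ K] (k : K) :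
    ∃ q : ℚ, algebraMap ℚ K q = ∏ g : K ≃ₐ[ℚ] K, g k := by
  classical
  have h := (IsGalois.mem_range_algebraMap_iff_fixed (F := ℚ) (∏ g : K ≃ₐ[ℚ] K, g k)).mpr
    (fun f => by
      rw [map_prod]
      exact Function.Bijective.prod_comp (Group.mulLeft_bijective f) (fun x : K ≃ₐ[ℚ] K => x k))
  obtain ⟨q, hq⟩ := h
  exact ⟨q, hq⟩

end Galois

end MultiQuadratic

end Literature.NumberTheory.GaloisRepresentations

/-! ### C2. Test elements for a Galois number field with many automorphisms -/

namespace Literature.NumberTheory.GaloisRepresentations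

namespace MultiQuadratic


variable {K : Type} [Field K] [NumberField K]

/-- A non-trivial automorphism moves some algebraic integer. [folklore] -/
theorem exists_moved {g : K ≃ₐ[ℚ] K} (hg : g ≠ 1) :
    ∃ x₀ : 𝓞 K, RingOfIntegers.mapRingHom (g : K →+* K) x₀ ≠ x₀ := by
  by_contra hcon
  push Not at hcon
  apply hg
  ext x
  obtain ⟨a, d, -, rfl⟩ := IsFractionRing.div_surjective (A := 𝓞 K) x
  have ha : g (a : K) = a := by
    have := congrArg (fun w : 𝓞 K => (w : K)) (hcon a)
    rwa [RingOfIntegers.mapRingHom_apply] at this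
  have hd : g (d : K) = d := by
    have := congrArg (fun w : 𝓞 K => (w : K)) (hcon d)
    rwa [RingOfIntegers.mapRingHom_apply] at this
  change g (algebraMap (𝓞 K) K a / algebraMap (𝓞 K) K d) = _
  rw [map_div₀, show algebraMap (𝓞 K) K a = (a : K) from rfl,
    show algebraMap (𝓞 K) K d = (d : K) from rfl, ha, hd, AlgEquiv.one_apply]

/-- **Test primes and elements for all automorphisms at once.**  For `C₀ ≠ 0` there are places
`𝔭₁, 𝔭₂, 𝔭₃` and integers `x₁, x₂, x₃` such that `k_j = 1 + C₀ x_j ∈ 𝔭_j` while `g(k_j) ∉ 𝔭_i`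
whenever `g ≠ 1` or `i ≠ j` (degree-one primes stable under no non-trivial automorphism have
density one; the Chinese remainder theorem over the `3 · #Gal` primes `g⁻¹ 𝔭_i`). [folklore] -/
theorem exists_test_elements' {C₀ : ℕ} (hC₀ : C₀ ≠ 0) :
    ∃ (x : Fin 3 → 𝓞 K) (𝔭 : Fin 3 → HeightOneSpectrum (𝓞 K)),
      (∀ (g : K ≃ₐ[ℚ] K) (i j : Fin 3), (g ≠ 1 ∨ i ≠ j) →
        RingOfIntegers.mapRingHom (g : K →+* K) (1 + C₀ * x j) ∉ (𝔭 i).asIdeal) ∧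
      (∀ j, (1 + C₀ * x j) ∈ (𝔭 j).asIdeal) := by
  classical
  set σ : (K ≃ₐ[ℚ] K) → (𝓞 K →+* 𝓞 K) := fun g => RingOfIntegers.mapRingHom (g : K →+* K)
    with hσdef
  have hσval : ∀ g (y : 𝓞 K), ((σ g y : 𝓞 K) : K) = g (y : K) := fun g y => rfl
  have hσ1 : ∀ y, σ 1 y = y := fun y => RingOfIntegers.ext (by rw [hσval]; rfl)
  have hσmul : ∀ g h y, σ (g * h) y = σ g (σ h y) := fun g h y =>
    RingOfIntegers.ext (by rw [hσval, hσval, hσval]; rfl)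
  -- conjugation of places
  obtain ⟨conj, hconj⟩ : ∃ conj : (K ≃ₐ[ℚ] K) → HeightOneSpectrum (𝓞 K) → HeightOneSpectrum (𝓞 K),
      ∀ g v y, y ∈ (conj g v).asIdeal ↔ σ g y ∈ v.asIdeal :=
    ⟨fun g v => ⟨Ideal.comap (σ g) v.asIdeal, Ideal.comap_isPrime (σ g) v.asIdeal,
      Quadratic.comap_ne_bot (σ g) v⟩, fun g v y => Ideal.mem_comap⟩
  have hconj1 : ∀ v, conj 1 v = v := by
    intro v; ext y; rw [hconj, hσ1]
  have hconjmul : ∀ g h v, conj g (conj h v) = conj (h * g) v := by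
    intro g h v; ext y; rw [hconj, hconj, hconj, hσmul]
  -- moved elements for `g ≠ 1`
  have hmv : ∀ g : K ≃ₐ[ℚ] K, ∃ z : 𝓞 K, (g ≠ 1 → z ≠ 0) ∧ (g ≠ 1 → ∃ x₀, z = x₀ - σ g x₀) := by
    intro g
    by_cases hg : g = 1
    · exact ⟨1, fun h => absurd hg h, fun h => absurd hg h⟩
    · obtain ⟨x₀, hx₀⟩ := exists_moved hg
      exact ⟨x₀ - σ g x₀, fun _ => sub_ne_zero.mpr (Ne.symm hx₀), fun _ => ⟨x₀, rfl⟩⟩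
  choose z hz0 hzx using hmv
  have hC : ((C₀ : ℕ) : 𝓞 K) ≠ 0 := by exact_mod_cast hC₀
  have hfinmem : ∀ {w : 𝓞 K}, w ≠ 0 → {v : HeightOneSpectrum (𝓞 K) | w ∈ v.asIdeal}.Finite := by
    intro w hw
    have hne : (Ideal.span {w} : Ideal (𝓞 K)) ≠ ⊥ := by rwa [Ne, Ideal.span_singleton_eq_bot]
    refine (Ideal.finite_factors hne).subset fun v hv => ?_
    simp only [Set.mem_setOf_eq] at hv ⊢
    exact (Ideal.dvd_span_singleton).mpr hv
  -- the good set
  have h𝓛 : HasDirichletDensity K {v : HeightOneSpectrum (𝓞 K) |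
      ((Ideal.absNorm v.asIdeal).Prime → ((Ideal.absNorm v.asIdeal : ℕ) : 𝓞 K) ∉ v.asIdeal ^ 2) ∧
      (((C₀ : ℕ) : 𝓞 K) ∉ v.asIdeal ∧ ∀ g : K ≃ₐ[ℚ] K, g ≠ 1 → z g ∉ v.asIdeal)} 1 := by
    refine hasDirichletDensity_one_of_eventually
      ((eventually_natCast_absNorm_not_mem_sq (K := K)).and ((Filter.eventually_cofinite.mpr
        ((hfinmem hC).subset fun v hv => by simpa using hv)).and ?_))
    rw [Filter.eventually_all]
    intro g
    by_cases hg : g = 1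
    · exact Filter.Eventually.of_forall fun v h => absurd hg h
    · exact Filter.eventually_cofinite.mpr ((hfinmem (hz0 g hg)).subset fun v hv => by
        simp only [Set.mem_setOf_eq, Classical.not_imp, not_not] at hv ⊢; exact hv.2)
  have hT := hasDirichletDensity_one_setOf_prime_absNorm K
  have hgood : ∀ v : HeightOneSpectrum (𝓞 K),
      v ∈ {v : HeightOneSpectrum (𝓞 K) |
        ((Ideal.absNorm v.asIdeal).Prime → ((Ideal.absNorm v.asIdeal : ℕ) : 𝓞 K) ∉ v.asIdeal ^ 2) ∧
        (((C₀ : ℕ) : 𝓞 K) ∉ v.asIdeal ∧ ∀ g : K ≃ₐ[ℚ] K, g ≠ 1 → z g ∉ v.asIdeal)} →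
      v ∈ {v : HeightOneSpectrum (𝓞 K) | (Ideal.absNorm v.asIdeal).Prime} →
      (∀ g : K ≃ₐ[ℚ] K, g ≠ 1 → conj g v ≠ v) ∧ ((C₀ : ℕ) : 𝓞 K) ∉ v.asIdeal := by
    intro v hv hvT
    simp only [Set.mem_setOf_eq] at hv hvT
    refine ⟨fun g hg hstab => hv.2.2 g hg ?_, hv.2.1⟩
    obtain ⟨x₀, hx₀⟩ := hzx g hg
    rw [hx₀]
    refine Quadratic.sub_map_mem_of_stable (σ g) v hvT rfl (hv.1 hvT) (fun y hy => ?_) x₀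
    rw [← hconj, hstab]; exact hy
  -- orbits are finite
  have horb : ∀ v : HeightOneSpectrum (𝓞 K),
      (Set.range fun g : K ≃ₐ[ℚ] K => conj g v).Finite := fun v => Set.finite_range _
  obtain ⟨𝔭₁, h𝔭₁𝓛, h𝔭₁T, -⟩ :=
    h𝓛.exists_mem_inter_not_mem_of_one_of_pos hT one_pos Set.finite_empty
  obtain ⟨𝔭₂, h𝔭₂𝓛, h𝔭₂T, h𝔭₂F⟩ :=
    h𝓛.exists_mem_inter_not_mem_of_one_of_pos hT one_pos (horb 𝔭₁)
  obtain ⟨𝔭₃, h𝔭₃𝓛, h𝔭₃T, h𝔭₃F⟩ :=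
    h𝓛.exists_mem_inter_not_mem_of_one_of_pos hT one_pos ((horb 𝔭₁).union (horb 𝔭₂))
  obtain ⟨h1, hC1⟩ := hgood 𝔭₁ h𝔭₁𝓛 h𝔭₁T
  obtain ⟨h2, hC2⟩ := hgood 𝔭₂ h𝔭₂𝓛 h𝔭₂T
  obtain ⟨h3, hC3⟩ := hgood 𝔭₃ h𝔭₃𝓛 h𝔭₃T
  obtain ⟨𝔭, h𝔭0, h𝔭1, h𝔭2⟩ : ∃ 𝔭 : Fin 3 → HeightOneSpectrum (𝓞 K),
      𝔭 0 = 𝔭₁ ∧ 𝔭 1 = 𝔭₂ ∧ 𝔭 2 = 𝔭₃ := ⟨![𝔭₁, 𝔭₂, 𝔭₃], rfl, rfl, rfl⟩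
  have h𝔭C : ∀ j, ((C₀ : ℕ) : 𝓞 K) ∉ (𝔭 j).asIdeal := by
    intro j; fin_cases j
    · simpa [h𝔭0] using hC1
    · simpa [h𝔭1] using hC2
    · simpa [h𝔭2] using hC3
  have hnst : ∀ j (g : K ≃ₐ[ℚ] K), g ≠ 1 → conj g (𝔭 j) ≠ 𝔭 j := by
    intro j; fin_cases j
    · simpa [h𝔭0] using h1
    · simpa [h𝔭1] using h2
    · simpa [h𝔭2] using h3
  -- different indices have disjoint orbits
  have horbit : ∀ i j (g : K ≃ₐ[ℚ] K), i ≠ j → conj g (𝔭 i) ≠ 𝔭 j := by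
    -- it suffices to treat `i < j` thanks to `conj g⁻¹`
    have key : ∀ g : K ≃ₐ[ℚ] K, (conj g 𝔭₁ ≠ 𝔭₂ ∧ conj g 𝔭₁ ≠ 𝔭₃ ∧ conj g 𝔭₂ ≠ 𝔭₃) := by
      intro g
      refine ⟨fun h => h𝔭₂F ⟨g, h⟩, fun h => h𝔭₃F (Or.inl ⟨g, h⟩), fun h => h𝔭₃F (Or.inr ⟨g, h⟩)⟩
    have flip : ∀ (g : K ≃ₐ[ℚ] K) (v w : HeightOneSpectrum (𝓞 K)), conj g v = w → conj g⁻¹ w = v := by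
      intro g v w h
      rw [← h, hconjmul, mul_inv_cancel, hconj1]
    intro i j g hij h
    fin_cases i <;> fin_cases j <;> simp only [h𝔭0, h𝔭1, h𝔭2, Fin.zero_eta, Fin.mk_one,
      Fin.isValue, Fin.reduceFinMk, ne_eq, not_true_eq_false] at hij h
    · exact (key g).1 h
    · exact (key g).2.1 h
    · exact (key g⁻¹).1 (flip g _ _ h)
    · exact (key g).2.2 h
    · exact (key g⁻¹).2.1 (flip g _ _ h)
    · exact (key g⁻¹).2.2 (flip g _ _ h)
  -- residues `t_j` with `1 + C₀ t_j ∈ 𝔭_j`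
  have ht : ∀ j, ∃ t : 𝓞 K, 1 + (C₀ : 𝓞 K) * t ∈ (𝔭 j).asIdeal := by
    intro j
    haveI := (𝔭 j).isMaximal
    letI := Ideal.Quotient.field (𝔭 j).asIdeal
    have hCj : (Ideal.Quotient.mk (𝔭 j).asIdeal ((C₀ : ℕ) : 𝓞 K)) ≠ 0 := by
      rw [Ne, Ideal.Quotient.eq_zero_iff_mem]
      exact h𝔭C j
    obtain ⟨t, ht⟩ := Ideal.Quotient.mk_surjective
      (-(Ideal.Quotient.mk (𝔭 j).asIdeal ((C₀ : ℕ) : 𝓞 K))⁻¹)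
    refine ⟨t, ?_⟩
    rw [← Ideal.Quotient.eq_zero_iff_mem, map_add, map_one, map_mul, ht, map_natCast,
      mul_neg, mul_inv_cancel₀ (by exact_mod_cast hCj), add_neg_cancel]
  choose t ht using ht
  -- the Chinese remainder theorem over `Fin 3 × Gal`
  set P : Fin 3 × (K ≃ₐ[ℚ] K) → Ideal (𝓞 K) := fun ig => (conj ig.2 (𝔭 ig.1)).asIdeal with hPdef
  have hPprime : ∀ ig ∈ (Finset.univ : Finset (Fin 3 × (K ≃ₐ[ℚ] K))), Prime (P ig) := by
    rintro ⟨i, g⟩ -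
    exact Ideal.prime_of_isPrime (conj g (𝔭 i)).ne_bot (conj g (𝔭 i)).isPrime
  have hPne : ∀ ig ∈ (Finset.univ : Finset (Fin 3 × (K ≃ₐ[ℚ] K))), ∀ ig' ∈ (Finset.univ :
      Finset (Fin 3 × (K ≃ₐ[ℚ] K))), ig ≠ ig' → P ig ≠ P ig' := by
    rintro ⟨i, g⟩ - ⟨i', g'⟩ - hne heq
    apply hne
    have hext : conj g (𝔭 i) = conj g' (𝔭 i') := HeightOneSpectrum.ext heq
    -- apply `conj g'⁻¹`: `conj (g g'⁻¹) (𝔭 i) = 𝔭 i'`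
    have h2 : conj (g * g'⁻¹) (𝔭 i) = 𝔭 i' := by
      rw [← hconjmul, hext, hconjmul, mul_inv_cancel, hconj1]
    by_cases hii : i = i'
    · subst hii
      have hgg : g * g'⁻¹ = 1 := by
        by_contra hne1
        exact hnst i _ hne1 h2
      rw [mul_inv_eq_one] at hgg
      rw [hgg]
    · exact absurd h2 (horbit i i' _ hii)
  have hx : ∀ j, ∃ y : 𝓞 K, y - t j ∈ (𝔭 j).asIdeal ∧
      ∀ (i : Fin 3) (g : K ≃ₐ[ℚ] K), (g ≠ 1 ∨ i ≠ j) → y ∈ (conj g (𝔭 i)).asIdeal := by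
    intro j
    obtain ⟨y, hy⟩ := IsDedekindDomain.exists_forall_sub_mem_ideal (s := Finset.univ) P
      (fun _ => 1) hPprime hPne (fun ig => if ig.1 = (j, (1 : K ≃ₐ[ℚ] K)) then t j else 0)
    refine ⟨y, ?_, fun i g hig => ?_⟩
    · have := hy (j, 1) (Finset.mem_univ _)
      simpa [hPdef, hconj1] using this
    · have := hy (i, g) (Finset.mem_univ _)
      have hne : ((i, g) : Fin 3 × (K ≃ₐ[ℚ] K)) ≠ (j, 1) := by
        intro h
        simp only [Prod.mk.injEq] at h
        rcases hig with hg | hij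
        · exact hg h.2
        · exact hij h.1
      simpa [hPdef, hne] using this
  choose x hxt hxc using hx
  refine ⟨x, 𝔭, fun g i j hgij => ?_, fun j => ?_⟩
  · have hmem := hxc j i g hgij
    rw [hconj] at hmem
    -- `σ g (1 + C₀ x_j) = 1 + C₀ σ g (x_j)` with `σ g x_j ∈ 𝔭_i`
    rw [show RingOfIntegers.mapRingHom (g : K →+* K) (1 + (C₀ : 𝓞 K) * x j) =
      1 + (C₀ : 𝓞 K) * σ g (x j) by rw [map_add, map_one, map_mul, map_natCast]]
    exact Quadratic.one_add_mul_not_mem (𝔭 i).isPrime.ne_top hmem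
  · have e : (1 : 𝓞 K) + C₀ * x j = (1 + C₀ * t j) + C₀ * (x j - t j) := by ring
    rw [e]
    exact (𝔭 j).asIdeal.add_mem (ht j) ((𝔭 j).asIdeal.mul_mem_left _ (hxt j))

end MultiQuadratic

end Literature.NumberTheory.GaloisRepresentations

/-! ### C4. BH Thm. 2.2 over composites of quadratic fields -/

namespace Literature.NumberTheory.GaloisRepresentations

namespace MultiQuadratic


section Helpers

variable {K : Type} [Field K] [NumberField K] {ℓ : ℕ} [Fact ℓ.Prime]
variable {E : Type} [NontriviallyNormedField E] [NormedAlgebra ℚ_[ℓ] E] [IsUltrametricDist E]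
  [CompleteSpace E]

include ℓ in
/-- `L(y^e) = e · L(y)` for `e = ±1` on principal units. [folklore] -/
theorem logSeries_zpow_unit {y : E} (hy : ‖1 - y‖ < 1) {e : ℤ} (he : e = 1 ∨ e = -1) :
    (∑' m : ℕ, -((1 - y ^ e) ^ (m + 1)) / (m + 1 : E)) =
      (e : E) * ∑' m : ℕ, -((1 - y) ^ (m + 1)) / (m + 1 : E) := by
  rcases he with rfl | rfl
  · simp
  · rw [zpow_neg, zpow_one, LogE.logSeries_inv (ℓ := ℓ) hy]; push_cast; ring

omit [Fact ℓ.Prime] in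
/-- `u ≡ 1 [ℓ^s]`, `s ≥ 1` ⇒ `u^e ≡ 1 [ℓ^s]` for `e = ±1`. [folklore] -/
theorem cong_zpow_unit_sub_one {s : ℕ} (hs : 1 ≤ s) {u : K}
    (hu : ∀ v : HeightOneSpectrum (𝓞 K), (ℓ : 𝓞 K) ∈ v.asIdeal →
      v.valuation K (u - 1) ≤ v.valuation K ((ℓ : K) ^ s)) {e : ℤ} (he : e = 1 ∨ e = -1) :
    ∀ v : HeightOneSpectrum (𝓞 K), (ℓ : 𝓞 K) ∈ v.asIdeal →
      v.valuation K (u ^ e - 1) ≤ v.valuation K ((ℓ : K) ^ s) := by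
  rcases he with rfl | rfl
  · simpa using hu
  · intro v hv
    have hu1 := Cong.valuation_eq_one_of_sub_one hs hu v hv
    have hu0 : u ≠ 0 := by rintro rfl; rw [Valuation.map_zero] at hu1; exact zero_ne_one hu1
    have e : u ^ (-1 : ℤ) - 1 = -(u - 1) * u⁻¹ := by rw [zpow_neg, zpow_one]; field_simp; ring
    rw [e]
    have := Cong.mul (Cong.neg hu) (Cong.zero_inv_of_sub_one hs hu) v hv
    rwa [add_zero] at this

end Helpers

variable {K : Type} [Field K] [NumberField K] {ℓ : ℕ} [Fact ℓ.Prime]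

/-- **Böckle–Hui Thm. 2.2 (Waldschmidt) for COMPOSITES OF QUADRATIC FIELDS**, in the idelic
rendering of `exists_heckeCharacter_of_weaklyDivides_of_thm22` (its hypothesis `h22`), proved:
for `K/ℚ` Galois with `Gal(K/ℚ)` of exponent `2` and a continuous `ψ : Γ_K → GL_1(ℚ̄_ℓ)` with
idelic avatar `Ψ` and algebraic Frobenius values almost everywhere, some power identity
`(∏_{v∣ℓ} Ψ(⟨k⟩_v))^N = ∏_τ τ(k)^{-n_τ}` holds for all `k ≡ 1 mod 𝔭_v^m` (`v ∣ ℓ`).  This is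
Serre's theorem, *Abelian ℓ-adic representations* Ch. III §3.4 ("`K` a composite of quadratic
extensions of `ℚ`"): along each eigen-line `k_χ = ∏_g g(k)^{χ(g)}` of a `±1`-character `χ` of
`Gal(K/ℚ)` the analytic expansion is one-dimensional and the `ℓ`-adic six exponentials theorem
applies (`line`), and `∏_χ k_χ = k^{#X}` (orthogonality).
[cite: SerreAbelianLadic1968, Ch. III §3.4] [cite: BockleHui2025, Theorem 2.2 (multiquadratic `K`)] -/
theorem pow_isLocallyAlgebraic_of_frobenius_isAlgebraic_multiquadratic [IsGalois ℚ K]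
    (h2 : ∀ g : K ≃ₐ[ℚ] K, g * g = 1)
    (ψ : FramedGaloisRep K (PadicAlgCl ℓ) 1) (Ψ : ideleGroup K →ₜ* (PadicAlgCl ℓ)ˣ)
    (hK : ∀ x ∈ principalIdeles K, Ψ x = 1)
    (hΨ : ∀ᶠ v : HeightOneSpectrum (𝓞 K) in cofinite, ψ.IsUnramifiedAt v ∧
      (∀ u : (v.adicCompletionIntegers K)ˣ,
          Ψ (localUnits v (Units.map ((v.adicCompletionIntegers K).subtype : _ →* _) u)) = 1) ∧
      ∀ ϖ : (v.adicCompletion K)ˣ, Valued.v (ϖ : v.adicCompletion K) = WithZero.exp (-1 : ℤ) →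
        ψ.HasFrobCharpolyAt v
          (Polynomial.X - Polynomial.C ((Ψ (localUnits v ϖ) : (PadicAlgCl ℓ)ˣ) : PadicAlgCl ℓ)))
    (halg : ∀ᶠ v : HeightOneSpectrum (𝓞 K) in cofinite, ψ.IsUnramifiedAt v ∧
      ∀ 𝔓 ∈ v.primesAbove, ∀ σ : absoluteGaloisGroup K, IsArithFrobAt (𝓞 K) σ 𝔓 →
        IsAlgebraic ℚ ((((ψ σ : GL (Fin 1) (PadicAlgCl ℓ)) :
          Matrix (Fin 1) (Fin 1) (PadicAlgCl ℓ)) 0 0)))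
    (L : Finset (HeightOneSpectrum (𝓞 K))) (hL : ∀ v, v ∈ L ↔ (ℓ : 𝓞 K) ∈ v.asIdeal) :
    ∃ N : ℕ, 0 < N ∧ ∃ (n : (K →+* PadicAlgCl ℓ) → ℤ) (m : ℕ), ∀ k : Kˣ,
      (∀ v ∈ L, Valued.v (algebraMap K (v.adicCompletion K) (k : K) - 1) ≤
          WithZero.exp (-(m : ℤ))) →
      (∏ v ∈ L, ((Ψ (localUnits v (globalToLocalUnits v k)) : (PadicAlgCl ℓ)ˣ) : PadicAlgCl ℓ)) ^ N =
        ∏ τ : K →+* PadicAlgCl ℓ, τ (k : K) ^ (-(n τ)) := by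
  classical
  have hp : ℓ.Prime := Fact.out
  set q₀ : ℝ := (ℓ : ℝ)⁻¹ with hq₀def
  have hq0 : 0 < q₀ := inv_pos.mpr (by exact_mod_cast hp.pos)
  have hq1 : q₀ < 1 := inv_lt_one_of_one_lt₀ (by exact_mod_cast hp.one_lt)
  -- ### Step 0: exceptional set, the product `f`, algebraic values, `NS`
  have hΨ' := hΨ
  have halg' := halg
  rw [Filter.eventually_cofinite] at hΨ' halg'
  set S : Finset (HeightOneSpectrum (𝓞 K)) := L ∪ hΨ'.toFinset ∪ halg'.toFinset with hSdef
  have hgoodΨ : ∀ w ∉ S, ψ.IsUnramifiedAt w ∧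
      (∀ u : (w.adicCompletionIntegers K)ˣ,
          Ψ (localUnits w (Units.map ((w.adicCompletionIntegers K).subtype : _ →* _) u)) = 1) ∧
      ∀ ϖ : (w.adicCompletion K)ˣ, Valued.v (ϖ : w.adicCompletion K) = WithZero.exp (-1 : ℤ) →
        ψ.HasFrobCharpolyAt w (Polynomial.X - Polynomial.C ((Ψ (localUnits w ϖ) :
          (PadicAlgCl ℓ)ˣ) : PadicAlgCl ℓ)) := by
    intro w hw
    by_contra hc
    exact hw (Finset.mem_union_left _ (Finset.mem_union_right _ (hΨ'.mem_toFinset.mpr hc)))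
  have hgoodalg : ∀ w ∉ S, ψ.IsUnramifiedAt w ∧
      ∀ 𝔓 ∈ w.primesAbove, ∀ σ : absoluteGaloisGroup K, IsArithFrobAt (𝓞 K) σ 𝔓 →
        IsAlgebraic ℚ ((((ψ σ : GL (Fin 1) (PadicAlgCl ℓ)) :
          Matrix (Fin 1) (Fin 1) (PadicAlgCl ℓ)) 0 0)) := by
    intro w hw
    by_contra hc
    exact hw (Finset.mem_union_right _ (halg'.mem_toFinset.mpr hc))
  have hS : ∀ w ∉ S, ∀ u : (w.adicCompletionIntegers K)ˣ,
      Ψ (localUnits w (Units.map ((w.adicCompletionIntegers K).subtype : _ →* _) u)) = 1 :=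
    fun w hw => (hgoodΨ w hw).2.1
  have halgΨ : ∀ w ∉ S, IsAlgebraic ℚ
      ((Ψ (localUnits w (HeckeCharacter.uniformizer K w)) : (PadicAlgCl ℓ)ˣ) : PadicAlgCl ℓ) := by
    intro w hw
    obtain ⟨𝔓, h𝔓⟩ := w.primesAbove_nonempty
    obtain ⟨Φ, hΦ⟩ := HeightOneSpectrum.exists_isArithFrobAt_of_mem_primesAbove_holds h𝔓
    have h1 := (FramedGaloisRep.hasFrobCharpolyAt_iff_of_rank_one ψ w _).mp
      ((hgoodΨ w hw).2.2 _ (HeckeCharacter.valued_uniformizer w)) 𝔓 h𝔓 Φ hΦ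
    rw [← h1]
    exact (hgoodalg w hw).2 𝔓 h𝔓 Φ hΦ
  have hSfilter : S.filter (fun v => (ℓ : 𝓞 K) ∈ v.asIdeal) = L := by
    ext v
    simp only [Finset.mem_filter, hSdef, Finset.mem_union]
    constructor
    · rintro ⟨-, hv⟩; exact (hL v).mpr hv
    · intro hv; exact ⟨Or.inl (Or.inl hv), (hL v).mp hv⟩
  set f : Kˣ →* (PadicAlgCl ℓ)ˣ :=
    ∏ v ∈ L, Ψ.toMonoidHom.comp ((localUnits v).comp (globalToLocalUnits (K := K) v)) with hfdef
  have hf : ∀ u : Kˣ, f u = ∏ v ∈ L, Ψ (localUnits v (globalToLocalUnits v u)) := by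
    intro u; rw [hfdef, MonoidHom.finsetProd_apply]; rfl
  have hfval : ∀ u : Kˣ, ((f u : (PadicAlgCl ℓ)ˣ) : PadicAlgCl ℓ) =
      ∏ v ∈ L, ((Ψ (localUnits v (globalToLocalUnits v u)) : (PadicAlgCl ℓ)ˣ) : PadicAlgCl ℓ) := by
    intro u; rw [hf, Units.coe_prod]
  have halgf : ∀ u : Kˣ, (∀ w ∈ S, (ℓ : 𝓞 K) ∉ w.asIdeal → w.valuation K (u : K) = 1) →
      IsAlgebraic ℚ ((f u : (PadicAlgCl ℓ)ˣ) : PadicAlgCl ℓ) := by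
    intro u hu
    have := IdelicCharacter.isAlgebraic_prod_map_localUnits Ψ hK S hS halgΨ u hu
    rwa [hSfilter, ← hf] at this
  set NS : ℕ := ∏ w ∈ S, Ideal.absNorm w.asIdeal with hNSdef
  have hNS0 : NS ≠ 0 := Finset.prod_ne_zero_iff.mpr fun w _ => by
    rw [Ne, Ideal.absNorm_eq_zero_iff]; exact w.ne_bot
  have hNS : ∀ w ∈ S, Ideal.absNorm w.asIdeal ∣ NS := fun w hw => Finset.dvd_prod_of_mem _ hw
  -- ### Step 1: Galois data
  haveI : Fintype ((K ≃ₐ[ℚ] K) →* ℤˣ) := Fintype.ofFinite _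
  set τ₁ : K →+* PadicAlgCl ℓ := Classical.arbitrary _ with hτ₁def
  set σ : (K ≃ₐ[ℚ] K) → (𝓞 K →+* 𝓞 K) := fun g => RingOfIntegers.mapRingHom (g : K →+* K)
    with hσdef
  have hσval : ∀ g (y : 𝓞 K), ((σ g y : 𝓞 K) : K) = g (y : K) := fun g y => rfl
  -- ### Step 2: analytic expansion in `ℂ_ℓ`
  set ιE : PadicAlgCl ℓ →+* ℂ_[ℓ] := algebraMap (PadicAlgCl ℓ) ℂ_[ℓ] with hιEdef
  have hι : ∀ x, ‖ιE x‖ = ‖x‖ := fun x => by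
    rw [hιEdef, ← PadicComplex.coe_eq]; exact PadicComplex.norm_extends ℓ x
  obtain ⟨s, hs2, lam, mu, hexp⟩ :=
    Expansion.exists_expansion Ψ ιE hι L (fun v hv => (hL v).mp hv) hq0
  set F : Kˣ →* ℂ_[ℓ] := (ιE.toMonoidHom.comp (Units.coeHom (PadicAlgCl ℓ))).comp f with hFdef
  have hF : ∀ u : Kˣ, F u = ιE ((f u : (PadicAlgCl ℓ)ˣ) : PadicAlgCl ℓ) := fun u => rfl
  have hFalg : ∀ u : Kˣ, (∀ w ∈ S, (ℓ : 𝓞 K) ∉ w.asIdeal → w.valuation K (u : K) = 1) →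
      @IsAlgebraic ℤ ℂ_[ℓ] _ _ (Ring.toIntAlgebra _) (F u) := by
    intro u hu
    rw [hF]
    exact FramedGaloisRep.isAlgebraic_int_map (instA := Ring.toIntAlgebra _)
      (instB := Ring.toIntAlgebra _) ιE
      ((IsFractionRing.isAlgebraic_iff ℤ ℚ (PadicAlgCl ℓ)).mpr (halgf u hu))
  -- ### Step 3: the eigen-lines
  set Θ : ((K ≃ₐ[ℚ] K) →* ℤˣ) → Kˣ → Kˣ := fun χ k =>
    ∏ g : K ≃ₐ[ℚ] K, (Units.map (g : K →* K) k) ^ ((χ g : ℤˣ) : ℤ) with hΘdef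
  have hΘval : ∀ χ (k : Kˣ), ((Θ χ k : Kˣ) : K) =
      ∏ g : K ≃ₐ[ℚ] K, (g (k : K)) ^ ((χ g : ℤˣ) : ℤ) := by
    intro χ k
    simp only [hΘdef]
    push_cast
    rfl
  -- congruence of the eigen-elements
  have hΘc : ∀ χ (s' : ℕ), 1 ≤ s' → ∀ k : Kˣ, (∀ v : HeightOneSpectrum (𝓞 K),
      (ℓ : 𝓞 K) ∈ v.asIdeal → v.valuation K ((k : K) - 1) ≤ v.valuation K ((ℓ : K) ^ s')) →
      ∀ v : HeightOneSpectrum (𝓞 K), (ℓ : 𝓞 K) ∈ v.asIdeal →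
        v.valuation K (((Θ χ k : Kˣ) : K) - 1) ≤ v.valuation K ((ℓ : K) ^ s') := by
    intro χ s' hs' k hk
    rw [hΘval]
    exact Cong.prod_sub_one _ _ fun g _ =>
      cong_zpow_unit_sub_one hs' (Quadratic.cong_map_sub_one (g : K →+* K) hk) (coe_chi_eq χ g)
  -- values at embeddings: `τ₁ (g (Θ k)) = (τ₁ Θ k)^{χ g}`
  have hΘaut : ∀ χ (k : Kˣ) (g : K ≃ₐ[ℚ] K),
      ιE ((τ₁.comp (g : K →+* K)) ((Θ χ k : Kˣ) : K)) =
        (ιE (τ₁ ((Θ χ k : Kˣ) : K))) ^ ((χ g : ℤˣ) : ℤ) := by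
    intro χ k g
    rw [RingHom.comp_apply, RingHom.coe_coe, hΘval, aut_prod_zpow, map_zpow₀, map_zpow₀]
  -- the line coefficients
  set Λ : ((K ≃ₐ[ℚ] K) →* ℤˣ) → ℂ_[ℓ] := fun χ =>
    ∑ g : K ≃ₐ[ℚ] K, (((χ g : ℤˣ) : ℤ) : ℂ_[ℓ]) * lam (τ₁.comp (g : K →+* K)) with hΛ
  set M : ((K ≃ₐ[ℚ] K) →* ℤˣ) → ℂ_[ℓ] := fun χ =>
    ∑ g : K ≃ₐ[ℚ] K, (((χ g : ℤˣ) : ℤ) : ℂ_[ℓ]) * mu τ₁ (τ₁.comp (g : K →+* K)) with hM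
  have hline : ∀ χ (k : Kˣ), (∀ v : HeightOneSpectrum (𝓞 K), (ℓ : 𝓞 K) ∈ v.asIdeal →
        v.valuation K ((k : K) - 1) ≤ v.valuation K ((ℓ : K) ^ s)) →
      ‖M χ * ∑' m : ℕ, -((1 - ιE (τ₁ (Θ χ k : K))) ^ (m + 1)) / (m + 1 : ℂ_[ℓ])‖ < (ℓ : ℝ)⁻¹ ∧
      ‖Λ χ * ∑' m : ℕ, -((1 - ιE (τ₁ (Θ χ k : K))) ^ (m + 1)) / (m + 1 : ℂ_[ℓ])‖ < (ℓ : ℝ)⁻¹ ∧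
      ιE (τ₁ (Θ χ k : K)) =
        exp (M χ * ∑' m : ℕ, -((1 - ιE (τ₁ (Θ χ k : K))) ^ (m + 1)) / (m + 1 : ℂ_[ℓ])) ∧
      F (Θ χ k) = exp (Λ χ * ∑' m : ℕ, -((1 - ιE (τ₁ (Θ χ k : K))) ^ (m + 1)) / (m + 1 : ℂ_[ℓ])) := by
    intro χ k hk
    obtain ⟨h1, hFn, hFe, hτ⟩ := hexp (Θ χ k) (hΘc χ s (by omega) k hk)
    obtain ⟨hMn, hMe⟩ := hτ τ₁
    have hy1 : ‖1 - ιE (τ₁ ((Θ χ k : Kˣ) : K))‖ < 1 :=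
      (h1 τ₁).trans_lt (pow_lt_one₀ hq0.le hq1 (by omega))
    -- collapse the sums over the embeddings to one variable
    have hcollapse : ∀ c : (K →+* PadicAlgCl ℓ) → ℂ_[ℓ],
        ∑ τ, c τ * ∑' m : ℕ, -((1 - ιE (τ ((Θ χ k : Kˣ) : K))) ^ (m + 1)) / (m + 1 : ℂ_[ℓ]) =
        (∑ g : K ≃ₐ[ℚ] K, (((χ g : ℤˣ) : ℤ) : ℂ_[ℓ]) * c (τ₁.comp (g : K →+* K))) *
          ∑' m : ℕ, -((1 - ιE (τ₁ ((Θ χ k : Kˣ) : K))) ^ (m + 1)) / (m + 1 : ℂ_[ℓ]) := by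
      intro c
      rw [sum_embeddings τ₁, Finset.sum_mul]
      refine Finset.sum_congr rfl fun g _ => ?_
      rw [hΘaut, logSeries_zpow_unit (ℓ := ℓ) hy1 (coe_chi_eq χ g)]
      ring
    rw [hcollapse] at hFn hFe
    rw [hcollapse] at hMn hMe
    refine ⟨hMn, hFn, hMe, ?_⟩
    rw [hF, hfval]
    exact hFe
  -- test elements
  have htest : ∀ χ (s' : ℕ), s ≤ s' → ∃ (kk : Fin 3 → Kˣ) (𝔭 : Fin 3 → HeightOneSpectrum (𝓞 K)),
      (∀ j, ∀ v : HeightOneSpectrum (𝓞 K), (ℓ : 𝓞 K) ∈ v.asIdeal →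
        v.valuation K ((kk j : K) - 1) ≤ v.valuation K ((ℓ : K) ^ s')) ∧
      (∀ j, ∀ v : HeightOneSpectrum (𝓞 K), (ℓ : 𝓞 K) ∈ v.asIdeal →
        v.valuation K (((Θ χ (kk j) : Kˣ) : K) - 1) ≤ v.valuation K ((ℓ : K) ^ s')) ∧
      (∀ j, @IsAlgebraic ℤ ℂ_[ℓ] _ _ (Ring.toIntAlgebra _) (F (Θ χ (kk j)))) ∧
      (∀ i j, i ≠ j → (𝔭 i).valuation K ((Θ χ (kk j) : Kˣ) : K) = 1) ∧
      (∀ j, (𝔭 j).valuation K ((Θ χ (kk j) : Kˣ) : K) < 1) := by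
    intro χ s' hss'
    have hC₀ : ℓ ^ s' * NS ≠ 0 := mul_ne_zero (pow_ne_zero _ hp.ne_zero) hNS0
    obtain ⟨x, 𝔭, hgx, hxj⟩ := exists_test_elements' (K := K) hC₀
    have hne0 : ∀ j, ((1 + ((ℓ ^ s' * NS : ℕ) : 𝓞 K) * x j : 𝓞 K) : K) ≠ 0 := by
      intro j h0
      have h1 : (1 + ((ℓ ^ s' * NS : ℕ) : 𝓞 K) * x j : 𝓞 K) = 0 := by exact_mod_cast h0
      have := hgx 1 (j + 1) j (Or.inr (by simp))
      rw [h1, map_zero] at this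
      exact this (𝔭 (j + 1)).asIdeal.zero_mem
    set kk : Fin 3 → Kˣ := fun j => Units.mk0 _ (hne0 j) with hkkdef
    have hkkval : ∀ j, ((kk j : Kˣ) : K) = ((1 + ((ℓ ^ s' * NS : ℕ) : 𝓞 K) * x j : 𝓞 K) : K) :=
      fun j => rfl
    have hgkk : ∀ (g : K ≃ₐ[ℚ] K) j, g ((kk j : Kˣ) : K) =
        ((σ g (1 + ((ℓ ^ s' * NS : ℕ) : 𝓞 K) * x j) : 𝓞 K) : K) := fun g j => by rw [hkkval, hσval]
    have hformσ : ∀ (g : K ≃ₐ[ℚ] K) j, ((σ g (1 + ((ℓ ^ s' * NS : ℕ) : 𝓞 K) * x j) : 𝓞 K) : K) =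
        (((1 + (NS : 𝓞 K) * (((ℓ ^ s' : ℕ) : 𝓞 K) * σ g (x j)) : 𝓞 K)) : K) := by
      intro g j
      rw [map_add, map_one, map_mul, map_natCast]
      push_cast; ring
    -- valuations of `g(kk j)` at the test primes
    have hvalg : ∀ (g : K ≃ₐ[ℚ] K) i j, (g ≠ 1 ∨ i ≠ j) →
        (𝔭 i).valuation K (g ((kk j : Kˣ) : K)) = 1 := by
      intro g i j hg
      rw [hgkk, show (((σ g (1 + ((ℓ ^ s' * NS : ℕ) : 𝓞 K) * x j)) : 𝓞 K) : K) =
        algebraMap (𝓞 K) K (σ g (1 + ((ℓ ^ s' * NS : ℕ) : 𝓞 K) * x j)) from rfl,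
        valuation_eq_one_iff_notMem]
      exact hgx g i j hg
    have hvalΘ : ∀ (v : HeightOneSpectrum (𝓞 K)) j, v.valuation K ((Θ χ (kk j) : Kˣ) : K) =
        ∏ g : K ≃ₐ[ℚ] K, (v.valuation K (g ((kk j : Kˣ) : K))) ^ ((χ g : ℤˣ) : ℤ) := by
      intro v j
      rw [hΘval, map_prod]
      simp only [map_zpow₀]
    refine ⟨kk, 𝔭, fun j => ?_, fun j => ?_, fun j => ?_, fun i j hij => ?_, fun j => ?_⟩
    · have e : ((kk j : Kˣ) : K) - 1 = (ℓ : K) ^ s' * (((NS : 𝓞 K) * x j : 𝓞 K) : K) := by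
        rw [hkkval]; push_cast; ring
      rw [e]
      have := Cong.mul (Cong.pow_self (K := K) (ℓ := ℓ) s')
        (Cong.zero_coe (K := K) (ℓ := ℓ) ((NS : 𝓞 K) * x j))
      rwa [add_zero] at this
    · refine hΘc χ s' (by omega) (kk j) fun v hv => ?_
      have e : ((kk j : Kˣ) : K) - 1 = (ℓ : K) ^ s' * (((NS : 𝓞 K) * x j : 𝓞 K) : K) := by
        rw [hkkval]; push_cast; ring
      rw [e]
      have := Cong.mul (Cong.pow_self (K := K) (ℓ := ℓ) s')
        (Cong.zero_coe (K := K) (ℓ := ℓ) ((NS : 𝓞 K) * x j))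
      rw [add_zero] at this
      exact this v hv
    · refine hFalg _ fun w hw _ => ?_
      rw [hvalΘ]
      refine Finset.prod_eq_one fun g _ => ?_
      rw [hgkk, hformσ, Quadratic.valuation_one_add_mul_eq_one (hNS w hw), one_zpow]
    · rw [hvalΘ]
      refine Finset.prod_eq_one fun g _ => ?_
      rw [hvalg g i j (Or.inr hij), one_zpow]
    · rw [hvalΘ, Finset.prod_eq_single (1 : K ≃ₐ[ℚ] K) (fun g _ hg => by
        rw [hvalg g j j (Or.inl hg), one_zpow]) (fun h => absurd (Finset.mem_univ _) h),
        map_one, Units.val_one, zpow_one, AlgEquiv.one_apply, hkkval]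
      exact ((𝔭 j).valuation_lt_one_iff_mem _).mpr (hxj j)
  -- the relations on the lines
  have hrel : ∀ χ, ∃ B : ℕ, 0 < B ∧ ∃ A : ℤ, ∀ k : Kˣ, (∀ v : HeightOneSpectrum (𝓞 K),
      (ℓ : 𝓞 K) ∈ v.asIdeal → v.valuation K ((k : K) - 1) ≤ v.valuation K ((ℓ : K) ^ s)) →
      F (Θ χ k) ^ B = (ιE (τ₁ ((Θ χ k : Kˣ) : K))) ^ A := fun χ =>
    line (ℓ := ℓ) ιE hι τ₁ (Θ χ) F hs2 (Λ χ) (M χ) (htest χ) (hline χ)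
  choose B hB A hBA using hrel
  -- ### Step 4: combination
  set Btot : ℕ := ∏ χ, B χ with hBtot
  have hBtot0 : 0 < Btot := Finset.prod_pos fun χ _ => hB χ
  have hBdvd : ∀ χ, B χ ∣ Btot := fun χ => Finset.dvd_prod_of_mem _ (Finset.mem_univ χ)
  -- the inverse of `g ↦ τ₁ ∘ g`
  set eqv : (K ≃ₐ[ℚ] K) ≃ (K →+* PadicAlgCl ℓ) := Equiv.ofBijective _ (bijective_comp τ₁) with heqv
  have heqv1 : ∀ g : K ≃ₐ[ℚ] K, eqv g = τ₁.comp (g : K →+* K) := fun g => rfl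
  have heqv2 : ∀ g : K ≃ₐ[ℚ] K, eqv.symm (τ₁.comp (g : K →+* K)) = g := fun g => by
    rw [← heqv1, Equiv.symm_apply_apply]
  -- the exponents
  set e : (K ≃ₐ[ℚ] K) → ℤ := fun g =>
    ∑ χ, ((χ g : ℤˣ) : ℤ) * (A χ * (Btot / B χ : ℕ)) with hedef
  -- the level
  have hMv : ∀ v : HeightOneSpectrum (𝓞 K), ∃ Mv : ℕ,
      v.valuation K (ℓ : K) = WithZero.exp (-(Mv : ℤ)) := by
    intro v
    have hne : (ℓ : 𝓞 K) ≠ 0 := by exact_mod_cast hp.ne_zero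
    refine ⟨(Associates.mk v.asIdeal).count (Associates.mk (Ideal.span {(ℓ : 𝓞 K)})).factors, ?_⟩
    rw [show (ℓ : K) = algebraMap (𝓞 K) K (ℓ : 𝓞 K) by simp, valuation_of_algebraMap,
      v.intValuation_if_neg hne]
  choose Mv hMv using hMv
  set m : ℕ := s * L.sup Mv with hmdef
  refine ⟨Fintype.card ((K ≃ₐ[ℚ] K) →* ℤˣ) * Btot, Nat.mul_pos Fintype.card_pos hBtot0,
    fun τ => -e (eqv.symm τ), m, fun k hk => ?_⟩
  -- the congruence
  have hkc : ∀ v : HeightOneSpectrum (𝓞 K), (ℓ : 𝓞 K) ∈ v.asIdeal →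
      v.valuation K ((k : K) - 1) ≤ v.valuation K ((ℓ : K) ^ s) := by
    intro v hv
    have hvL : v ∈ L := (hL v).mpr hv
    have h1 := hk v hvL
    rw [← map_one (algebraMap K (v.adicCompletion K)), ← map_sub, valued_algebraMap_adicCompletion]
      at h1
    refine h1.trans ?_
    rw [Valuation.map_pow, hMv v, ← WithZero.exp_nsmul, WithZero.exp_le_exp, nsmul_eq_mul]
    have := Finset.le_sup (f := Mv) hvL
    have : (s : ℤ) * (Mv v : ℤ) ≤ (m : ℤ) := by
      rw [hmdef]; push_cast; exact mul_le_mul_of_nonneg_left (by exact_mod_cast this) (by positivity)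
    linarith
  -- `k^{#X} = ∏_χ Θ χ k` in `Kˣ`
  have hkX : k ^ (Fintype.card ((K ≃ₐ[ℚ] K) →* ℤˣ)) = ∏ χ, Θ χ k := by
    apply Units.ext
    rw [Units.val_pow_eq_pow_val, Units.coe_prod]
    simp only [hΘval]
    exact (prod_prod_zpow h2 k.ne_zero).symm
  -- `F(k)^N = ∏_g ι(τ₁ g k)^{e g}`
  have hιgk : ∀ g : K ≃ₐ[ℚ] K, ιE (τ₁ (g (k : K))) ≠ 0 := fun g =>
    (map_ne_zero ιE).mpr ((map_ne_zero τ₁).mpr ((map_ne_zero g).mpr k.ne_zero))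
  have hFk : F k ^ (Fintype.card ((K ≃ₐ[ℚ] K) →* ℤˣ) * Btot) =
      ∏ g : K ≃ₐ[ℚ] K, (ιE (τ₁ (g (k : K)))) ^ e g := by
    rw [pow_mul, ← map_pow, hkX, map_prod, ← Finset.prod_pow]
    have h1 : ∀ χ, F (Θ χ k) ^ Btot = ∏ g : K ≃ₐ[ℚ] K,
        (ιE (τ₁ (g (k : K)))) ^ (((χ g : ℤˣ) : ℤ) * (A χ * (Btot / B χ : ℕ))) := by
      intro χ
      conv_lhs => rw [(Nat.mul_div_cancel' (hBdvd χ)).symm]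
      rw [pow_mul, hBA χ k hkc, ← zpow_natCast, ← zpow_mul,
        hΘval, map_prod, map_prod, ← Finset.prod_zpow]
      refine Finset.prod_congr rfl fun g _ => ?_
      rw [map_zpow₀, map_zpow₀, ← zpow_mul]
    simp_rw [h1]
    rw [Finset.prod_comm]
    refine Finset.prod_congr rfl fun g _ => ?_
    rw [hedef, prod_zpow_eq_zpow_sum (K := ℂ_[ℓ]) _ _ (hιgk g)]
  -- back to `ℚ̄_ℓ` and to the embeddings
  have hfk : ((f k : (PadicAlgCl ℓ)ˣ) : PadicAlgCl ℓ) ^ (Fintype.card ((K ≃ₐ[ℚ] K) →* ℤˣ) * Btot) =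
      ∏ g : K ≃ₐ[ℚ] K, (τ₁ (g (k : K))) ^ e g := by
    apply ιE.injective
    rw [map_pow, ← hF, hFk, map_prod]
    simp only [map_zpow₀]
  rw [← hfval, hfk, prod_embeddings τ₁]
  refine Finset.prod_congr rfl fun g _ => ?_
  rw [neg_neg, heqv2]
  rfl

end MultiQuadratic

end Literature.NumberTheory.GaloisRepresentations

/-! ### Böckle–Hui Thm. 1.1 (characters) over composites of quadratic fields, unconditional -/

namespace Literature.NumberTheory.GaloisRepresentations


/-- **Böckle–Hui 2025, Thm. 1.1 for characters over COMPOSITES OF QUADRATIC FIELDS (Hecke form of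
the named fact `exists_heckeCharacter_of_weaklyDivides`), proved unconditionally** (Thm. 2.2 being
`MultiQuadratic.pow_isLocallyAlgebraic_of_frobenius_isAlgebraic_multiquadratic`).
[cite: BockleHui2025, Theorem 1.1 (multiquadratic `K`)] [cite: SerreAbelianLadic1968, Ch. III §3.4] -/
theorem exists_heckeCharacter_of_weaklyDivides_multiquadratic (K : Type) [Field K] [NumberField K]
    [IsGalois ℚ K] (h2 : ∀ g : K ≃ₐ[ℚ] K, g * g = 1) (ℓ : ℕ) [Fact ℓ.Prime] (n : ℕ)
    (E : Type) [Field E] [NumberField E] (e : E →+* PadicAlgCl ℓ)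
    (ρ : FramedGaloisRep K (PadicAlgCl ℓ) n) (hρ : ρ.IsRationalOver e)
    (ψ : FramedGaloisRep K (PadicAlgCl ℓ) 1) (h : ψ.WeaklyDivides ρ) (ι : PadicAlgCl ℓ ≃+* ℂ) :
    ∃ χ : HeckeCharacter K, χ.IsAlgebraic ∧
      ∀ᶠ v : HeightOneSpectrum (𝓞 K) in cofinite, χ.IsUnramifiedAt v ∧ ψ.IsUnramifiedAt v ∧
        ψ.HasFrobCharpolyAt v (X - C (ι.symm (χ.valueAtUniformizer v)⁻¹)) := by
  classical
  obtain ⟨Ψ, hK, hΨ⟩ := ψ.exists_idelicCharacter_eventually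
  have hfin : {v : HeightOneSpectrum (𝓞 K) | (ℓ : 𝓞 K) ∈ v.asIdeal}.Finite := by
    have hne : (Ideal.span {(ℓ : 𝓞 K)} : Ideal (𝓞 K)) ≠ ⊥ := by
      rw [Ne, Ideal.span_singleton_eq_bot, Nat.cast_eq_zero]
      exact (Fact.out : ℓ.Prime).ne_zero
    refine (Ideal.finite_factors hne).subset fun v hv => ?_
    simp only [Set.mem_setOf_eq] at hv ⊢
    exact (Ideal.dvd_span_singleton).mpr hv
  set L : Finset (HeightOneSpectrum (𝓞 K)) := hfin.toFinset with hLdef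
  have hL : ∀ v, v ∈ L ↔ (ℓ : 𝓞 K) ∈ v.asIdeal := fun v => hfin.mem_toFinset
  have halg : ∀ᶠ v : HeightOneSpectrum (𝓞 K) in cofinite, ψ.IsUnramifiedAt v ∧
      ∀ 𝔓 ∈ v.primesAbove, ∀ σ : absoluteGaloisGroup K, IsArithFrobAt (𝓞 K) σ 𝔓 →
        IsAlgebraic ℚ ((((ψ σ : GL (Fin 1) (PadicAlgCl ℓ)) :
          Matrix (Fin 1) (Fin 1) (PadicAlgCl ℓ)) 0 0)) :=
    (FramedGaloisRep.WeaklyDivides.eventually_isAlgebraic e hρ h).mono fun v hv => ⟨hv.2.1, hv.2.2⟩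
  obtain ⟨N, hN, nn, m, hLA⟩ :=
    MultiQuadratic.pow_isLocallyAlgebraic_of_frobenius_isAlgebraic_multiquadratic h2 ψ Ψ hK hΨ
      halg L hL
  exact FramedGaloisRep.WeaklyDivides.exists_heckeCharacter_of_almostLocAlg e hρ h Ψ hK hΨ L hL hN
    nn m hLA ι

end Literature.NumberTheory.GaloisRepresentations
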